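import Mathlib
import Literature.Computability.Complexity.CNF
import Summits.PneNP.PneNP.Theorems.OverlapGapAlgebraSolvableImpliesStableSectionEngine
import Summits.PneNP.PneNP.Theorems.OverlapGapAlgebraSolvableImpliesStableSectionLipschitzTransferBoost
import Summits.PneNP.PneNP.Theorems.OverlapGapAlgebraSolvableImpliesStableSectionMeanSquareTransferBoost

/-!
# PneNP / OverlapGapAlgebra — crux `SolvableImpliesStableSection` (stmt-PneNP-2463):
# the mean-square transfer from POLYNOMIALLY SMALL success

Support for crux `stmt-PneNP-2463` (`Summit.PneNP.PneNP.Theses.OverlapGapAlgebra.SolvableImpliesStableSection`).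
The crux asks for a stable section from success probability `≥ ε` (a constant) of a polynomial-time
solver. For ℓ²-stable solvers (mean-square single-literal-resample sensitivity `s₂(n)`,
`s₂ log³ n = o(n)`; file `…MeanSquareTransfer`) the hypothesis can be weakened QUANTITATIVELY: the
success level enters the mechanism only through the boost condition `8k(2 + 9 s₂ log² n) ≤ ε ν² m`,
so success probability `≥ 8k(2 + 9 s₂(n) log² n)/(ν² m) = O((1 + s₂ log² n)/n)` already forces the
path event of the crux.

* `sissMSR_concl_of_rateSolver` — map form: at `(k, α, η, ν)`, if infinitely often some map `g` with
  `∑_{(a,b)} ∑_{(Φ,ℓ)} d_H(g Φ, g Φ[(a,b) ↦ ℓ])² ≤ s₂(n)·(m k)·#Inst·2n` satisfies at least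
  `(8k(2 + 9 s₂(n) log² n)/(ν² m))·#Inst` instances, then the crux's conclusion holds for every `c > 0`;
* `sissMSR_stableSection_of_rateSolvable` — the crux's shape for `f : List Bool → List Bool` with
  ℓ²-stable decoded sections: `IsPolyTime f` replaced by the sensitivity bound and `∃ ε > 0, Pr ≥ ε`
  replaced by `Pr[f solves] ≥ 8k(2 + 9 s₂(n) log² n)/(ν² m)` infinitely often.
No new definitions; axioms `propext`, `Classical.choice`, `Quot.sound`.
-/

set_option linter.dupNamespace false -- `Summit.PneNP.PneNP.…`: summit = sub-problem (D-0017)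

namespace Summit.PneNP.PneNP.Theorems

open Finset Filter Asymptotics
open scoped Classical

/-- **The mean-square transfer from POLYNOMIALLY SMALL success (map form).** For every `k ≥ 1`,
`α, η, ν > 0` and every `s₂ : ℕ → ℝ` with `s₂(n) log³ n = o(n)`: if, for infinitely many `n`
(`m = ⌊α n⌋₊`), some map `g` of mean-square single-literal-resample sensitivity at most `s₂(n) ≥ 0`
satisfies at least `(8k(2 + 9 s₂(n) log² n)/(ν² m))·#Inst` instances of `F_k(n, m)` — a success
probability that may tend to zero like `(1 + s₂ log² n)/n` — then for every `c > 0`, infinitely often,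
some map (such a `g` itself) realises the path event of `SolvableImpliesStableSection` on at least
`e^{-cn}·#paths` of the path tuples. (Same proof as `sissMS_concl_of_meanSquareStableSolver`: the
success level enters only through the boost condition `8k(2 + 9 s₂ log² n) ≤ ε ν² m`, which this
threshold satisfies by definition; the loss rate of the walk engine does not see `ε`.) -/
theorem sissMSR_concl_of_rateSolver (k : ℕ) (hk : 1 ≤ k) (α η ν : ℝ) (hα : 0 < α)
    (hη : 0 < η) (hν : 0 < ν) (s₂ : ℕ → ℝ)
    (hs : (fun n : ℕ => s₂ n * Real.log n ^ 3) =o[atTop] (fun n : ℕ => (n : ℝ)))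
    (hsolv : ∃ᶠ n : ℕ in atTop, ∀ m : ℕ, m = ⌊α * n⌋₊ →
      ∃ g : (Fin m → Fin k → Fin n × Bool) → (Fin n → Bool), 0 ≤ s₂ n ∧
        (∑ a : Fin m, ∑ b : Fin k, ∑ p : (Fin m → Fin k → Fin n × Bool) × (Fin n × Bool),
          (hammingDist (g p.1) (g (Function.update p.1 a (Function.update (p.1 a) b p.2))) : ℝ) ^ 2)
          ≤ s₂ n * (((m * k : ℕ) : ℝ) * (Fintype.card (Fin m → Fin k → Fin n × Bool) * (2 * n))) ∧
        8 * k * (2 + 9 * Real.log n ^ 2 * s₂ n) / (ν ^ 2 * m)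
            * Fintype.card (Fin m → Fin k → Fin n × Bool) ≤
          ((Finset.univ.filter fun Φ : Fin m → Fin k → Fin n × Bool =>
            ∀ i, ∃ j, g Φ (Φ i j).1 = (Φ i j).2).card : ℝ))
    (c : ℝ) (hc : 0 < c) :
    ∃ᶠ n : ℕ in atTop, ∀ m : ℕ, m = ⌊α * n⌋₊ →
      ∃ g : (Fin m → Fin k → Fin n × Bool) → (Fin n → Bool),
        Real.exp (-(c * n)) * Fintype.card (Fin (k + 1) → Fin m → Fin k → Fin n × Bool) ≤
        ((Finset.univ.filter fun Ψ : Fin (k + 1) → Fin m → Fin k → Fin n × Bool =>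
          let P : Fin k → ℕ → Fin m → Fin k → Fin n × Bool :=
            fun r q a b => if (a : ℕ) * k + b < q then Ψ r.succ a b else Ψ r.castSucc a b
          (∀ r : Fin k, ∀ q ≤ m * k, ((Finset.univ.filter fun i : Fin m =>
            ∀ j, g (P r q) (P r q i j).1 ≠ (P r q i j).2).card : ℝ) ≤ ν * m) ∧
          ∀ r : Fin k, ∀ q < m * k,
            (hammingDist (g (P r q)) (g (P r (q + 1))) : ℝ) ≤ η * n).card : ℝ) := by
  have hkR : (1 : ℝ) ≤ k := by exact_mod_cast hk
  have hk0 : (0 : ℝ) < k := by linarith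
  -- the small constant `δ`
  obtain ⟨δ, hδpos, hδa, hδη, hδc, hδb⟩ : ∃ δ : ℝ, 0 < δ ∧
      δ ≤ 1 * ν ^ 2 * α / (144 * k) ∧ δ ≤ η ^ 2 / (k * α) ∧ δ ≤ c * ν ^ 2 / (576 * k ^ 3) ∧
      δ ≤ α * ν ^ 2 / (288 * k) := by
    refine ⟨min (1 * ν ^ 2 * α / (144 * k))
      (min (η ^ 2 / (k * α)) (min (c * ν ^ 2 / (576 * k ^ 3)) (α * ν ^ 2 / (288 * k)))), ?_,
      min_le_left _ _, (min_le_right _ _).trans (min_le_left _ _),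
      ((min_le_right _ _).trans (min_le_right _ _)).trans (min_le_left _ _),
      ((min_le_right _ _).trans (min_le_right _ _)).trans (min_le_right _ _)⟩
    refine lt_min ?_ (lt_min ?_ (lt_min ?_ ?_)) <;> positivity
  -- eventual conditions in `n`
  have C0 : ∀ᶠ n : ℕ in atTop, 3 ≤ n := eventually_ge_atTop 3
  have C1 : ∀ᶠ n : ℕ in atTop, s₂ n * Real.log n ^ 3 ≤ δ * n := by
    filter_upwards [hs.def hδpos] with n hn
    rw [Real.norm_eq_abs, Real.norm_eq_abs, Nat.abs_cast] at hn
    exact (le_abs_self _).trans hn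
  have C3 : ∀ᶠ n : ℕ in atTop, (16 * k + 1 * ν ^ 2) * 2 / (1 * ν ^ 2 * α) ≤ (n : ℝ) :=
    tendsto_natCast_atTop_atTop.eventually_ge_atTop _
  have C4 : ∀ᶠ n : ℕ in atTop, (1 + 64 * k ^ 3 / ν ^ 2 + 8 * k) * Real.log n ≤ c * n / 2 := by
    have hlo := Real.isLittleO_log_id_atTop.comp_tendsto tendsto_natCast_atTop_atTop
    have hK : (0 : ℝ) < 1 + 64 * k ^ 3 / ν ^ 2 + 8 * k := by positivity
    have hpos : 0 < c / (2 * (1 + 64 * k ^ 3 / ν ^ 2 + 8 * k)) := by positivity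
    filter_upwards [hlo.def hpos] with n hn
    simp only [Function.comp_apply, id_eq, Real.norm_eq_abs, Nat.abs_cast] at hn
    have h1 : Real.log n ≤ c / (2 * (1 + 64 * k ^ 3 / ν ^ 2 + 8 * k)) * n := (le_abs_self _).trans hn
    calc (1 + 64 * k ^ 3 / ν ^ 2 + 8 * k) * Real.log n
        ≤ (1 + 64 * k ^ 3 / ν ^ 2 + 8 * k) * (c / (2 * (1 + 64 * k ^ 3 / ν ^ 2 + 8 * k)) * n) :=
          mul_le_mul_of_nonneg_left h1 hK.le
      _ = c * n / 2 := by field_simp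
  have C5 : ∀ᶠ n : ℕ in atTop, 2 * (32 * k ^ 3 / ν ^ 2 + 4 * k + 1 + k ^ 2) / (k ^ 2 * α) ≤ (n : ℝ) :=
    tendsto_natCast_atTop_atTop.eventually_ge_atTop _
  have C7 : ∀ᶠ n : ℕ in atTop, α ^ 2 * Real.exp (α * k * Real.exp 2) ≤ (n : ℝ) :=
    tendsto_natCast_atTop_atTop.eventually_ge_atTop _
  have C8 : ∀ᶠ n : ℕ in atTop, α * ν ^ 2 * Real.exp (α * k * Real.exp 2) ≤ (n : ℝ) :=
    tendsto_natCast_atTop_atTop.eventually_ge_atTop _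
  have hev : ∀ᶠ n : ℕ in atTop, 3 ≤ n ∧ s₂ n * Real.log n ^ 3 ≤ δ * n ∧
      (16 * k + 1 * ν ^ 2) * 2 / (1 * ν ^ 2 * α) ≤ (n : ℝ) ∧
      (1 + 64 * k ^ 3 / ν ^ 2 + 8 * k) * Real.log n ≤ c * n / 2 ∧
      2 * (32 * k ^ 3 / ν ^ 2 + 4 * k + 1 + k ^ 2) / (k ^ 2 * α) ≤ (n : ℝ) ∧
      α ^ 2 * Real.exp (α * k * Real.exp 2) ≤ (n : ℝ) ∧
      α * ν ^ 2 * Real.exp (α * k * Real.exp 2) ≤ (n : ℝ) := by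
    filter_upwards [C0, C1, C3, C4, C5, C7, C8] with n h0 h1 h3 h4 h5 h7 h8
    exact ⟨h0, h1, h3, h4, h5, h7, h8⟩
  refine (hsolv.and_eventually hev).mono ?_
  rintro n ⟨hn, hn3, hC1, hC3, hC4, hC5, hC7, hC8⟩ m hm
  obtain ⟨g, hs0n, hg, hsucc⟩ := hn m hm
  refine ⟨g, ?_⟩
  -- numerics of `n` and `m`
  have hn1 : 1 ≤ n := le_trans (by norm_num) hn3
  have hnR : (1 : ℝ) ≤ n := by exact_mod_cast hn1
  have hn3R : (3 : ℝ) ≤ n := by exact_mod_cast hn3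
  have hnpos : (0 : ℝ) < n := by linarith only [hnR]
  have hxpos : (0 : ℝ) < 2 * n := by linarith only [hnR]
  have hlog2le : Real.log 2 ≤ Real.log (2 * n) := Real.log_le_log two_pos (by linarith only [hnR])
  have hlog1 : 1 ≤ Real.log n := by
    rw [← Real.log_exp 1]
    apply Real.log_le_log (Real.exp_pos 1)
    have : Real.exp 1 ≤ 3 := le_of_lt (lt_trans Real.exp_one_lt_d9 (by norm_num))
    exact this.trans hn3R
  have hm_le : (m : ℝ) ≤ α * n := by rw [hm]; exact Nat.floor_le (by positivity)
  have hm_ge : α * n - 1 ≤ m := by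
    rw [hm]; have := Nat.lt_floor_add_one (α * n); linarith only [this]
  have hC1' : s₂ n * Real.log n ^ 3 ≤ δ * n := hC1
  set N : ℝ := (Fintype.card (Fin m → Fin k → Fin n × Bool) : ℝ) with hN
  obtain ⟨hm1, hjumpB, -, ht, hMB⟩ := sissMS_numerics k hk α η ν 1 c δ (s₂ n) hα hν one_pos hc hs0n
    hδa hδη hδc hδb n m hn3 hC1' hC3 hC4 hC5 hm_ge hm_le
  have hmR : (1 : ℝ) ≤ m := by exact_mod_cast hm1
  have hmpos : (0 : ℝ) < m := by linarith only [hmR]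
  -- the success threshold `εn = 8k(2 + 9 s₂ log² n)/(ν² m)`
  obtain ⟨εn, hεn⟩ : ∃ εn : ℝ, εn = 8 * k * (2 + 9 * Real.log n ^ 2 * s₂ n) / (ν ^ 2 * m) := ⟨_, rfl⟩
  have hεpos : 0 < εn := by rw [hεn]; positivity
  have hsucc' : εn * Fintype.card (Fin m → Fin k → Fin n × Bool) ≤
      ((Finset.univ.filter fun Φ : Fin m → Fin k → Fin n × Bool =>
        ∀ i, ∃ j, g Φ (Φ i j).1 = (Φ i j).2).card : ℝ) := by rw [hεn]; exact hsucc
  -- the degree level `L = ⌈2 log n⌉₊ ≤ 3 log n`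
  set L : ℕ := ⌈2 * Real.log n⌉₊ with hL
  have hLge : 2 * Real.log n ≤ L := Nat.le_ceil _
  have hLle : (L : ℝ) ≤ 3 * Real.log n := by
    have := Nat.ceil_lt_add_one (show 0 ≤ 2 * Real.log n by positivity)
    rw [← hL] at this
    linarith only [this, hlog1]
  have hL9 : (L : ℝ) ^ 2 * s₂ n ≤ 9 * Real.log n ^ 2 * s₂ n := by
    have h1 : (L : ℝ) ^ 2 ≤ (3 * Real.log n) ^ 2 := pow_le_pow_left₀ (Nat.cast_nonneg _) hLle 2
    have h2 : (3 * Real.log n) ^ 2 = 9 * Real.log n ^ 2 := by ring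
    rw [← h2]
    exact mul_le_mul_of_nonneg_right h1 hs0n
  -- the exceptional set (maximum clause-degree `> L`) is negligible
  haveI : Nonempty (Fin n × Bool) := ⟨(⟨0, hn1⟩, true)⟩
  have hNpos : 0 < N := by rw [hN]; exact_mod_cast Fintype.card_pos
  have hBad := (sissT_bad_bounds (m := m) (k := k) (n := n) hn1 α ν hα.le hν L hm_le hLge hC7 hC8).1
  -- the loss rate `A` and the good set `G`
  obtain ⟨A, hA⟩ : ∃ A : ℝ, A = 4 * k * (k * (2 + 9 * Real.log n ^ 2 * s₂ n)) / ν ^ 2 + 1 := ⟨_, rfl⟩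
  have hA0 : 0 ≤ A := by rw [hA]; positivity
  have hA1 : 1 ≤ A := by
    rw [hA]
    have : 0 ≤ 4 * k * (k * (2 + 9 * Real.log n ^ 2 * s₂ n)) / ν ^ 2 := by positivity
    linarith only [this]
  have hν2 : 0 < ν ^ 2 := by positivity
  have hAL : 4 * k * (k * (2 + (L : ℝ) ^ 2 * s₂ n)) / ν ^ 2 ≤ A := by
    rw [hA]
    have h1 : 4 * (k : ℝ) * (k * (2 + (L : ℝ) ^ 2 * s₂ n)) ≤ 4 * k * (k * (2 + 9 * Real.log n ^ 2 * s₂ n)) := by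
      apply mul_le_mul_of_nonneg_left _ (by positivity)
      apply mul_le_mul_of_nonneg_left _ hk0.le
      linarith only [hL9]
    have h2 := div_le_div_of_nonneg_right h1 hν2.le
    linarith only [h2]
  rw [← hA] at ht hMB
  have h8BL : 8 * (k * (2 + (L : ℝ) ^ 2 * s₂ n)) ≤ εn * ν ^ 2 * m := by
    have : 8 * ((k : ℝ) * (2 + (L : ℝ) ^ 2 * s₂ n)) ≤ 8 * (k * (2 + 9 * Real.log n ^ 2 * s₂ n)) := by
      apply mul_le_mul_of_nonneg_left _ (by norm_num)
      apply mul_le_mul_of_nonneg_left _ hk0.le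
      linarith only [hL9]
    have hε8 : εn * ν ^ 2 * m = 8 * (k * (2 + 9 * Real.log n ^ 2 * s₂ n)) := by
      rw [hεn]; field_simp
    rw [hε8]; exact this
  obtain ⟨G, hGdef⟩ : ∃ G : Finset (Fin m → Fin k → Fin n × Bool),
      G = (univ : Finset (Fin m → Fin k → Fin n × Bool)).filter fun Φ =>
        ((((univ : Finset (Fin m)).filter fun i => ∀ j, g Φ (Φ i j).1 ≠ (Φ i j).2).card : ℕ) : ℝ)
          ≤ ν * m := ⟨_, rfl⟩
  have hval : ∀ Φ ∈ G, ((((univ : Finset (Fin m)).filter fun i =>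
      ∀ j, g Φ (Φ i j).1 ≠ (Φ i j).2).card : ℕ) : ℝ) ≤ ν * m := fun Φ hΦ => by
    rw [hGdef] at hΦ
    exact (Finset.mem_filter.1 hΦ).2
  have hG : ((k * m : ℕ) : ℝ) * (Gᶜ.card : ℝ) ≤ A * Fintype.card (Fin m → Fin k → Fin n × Bool) := by
    have h := sissMS_km_card_invalid_le hn1 hm1 g (s₂ n) ν εn hs0n hν hεpos L hg hBad hsucc' h8BL G
      hGdef
    exact h.trans (mul_le_mul_of_nonneg_right hAL (Nat.cast_nonneg _))
  -- jump mass by Markov on the squared sensitivity: total `≤ #Inst · 2n ≤ A · #Inst · 2n`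
  have hjump : (∑ a : Fin m, ∑ b : Fin k,
      (((Finset.univ : Finset ((Fin m → Fin k → Fin n × Bool) × (Fin n × Bool))).filter
        fun p => η * n < hammingDist (g p.1)
          (g (Function.update p.1 a (Function.update (p.1 a) b p.2)))).card : ℝ))
      ≤ A * (Fintype.card (Fin m → Fin k → Fin n × Bool) * (2 * n)) := by
    have hηn : 0 < (η * n) ^ 2 := by positivity
    have hsum : (η * n) ^ 2 * (∑ a : Fin m, ∑ b : Fin k,
        (((Finset.univ : Finset ((Fin m → Fin k → Fin n × Bool) × (Fin n × Bool))).filter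
          fun p => η * n < hammingDist (g p.1)
            (g (Function.update p.1 a (Function.update (p.1 a) b p.2)))).card : ℝ))
        ≤ ∑ a : Fin m, ∑ b : Fin k, ∑ p : (Fin m → Fin k → Fin n × Bool) × (Fin n × Bool),
          (hammingDist (g p.1) (g (Function.update p.1 a (Function.update (p.1 a) b p.2))) : ℝ) ^ 2 := by
      rw [Finset.mul_sum]
      refine Finset.sum_le_sum fun a _ => ?_
      rw [Finset.mul_sum]
      exact Finset.sum_le_sum fun b _ => sissMS_card_jump_le g (η * n) (by positivity) a b
    have hchain : (η * n) ^ 2 * (∑ a : Fin m, ∑ b : Fin k,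
        (((Finset.univ : Finset ((Fin m → Fin k → Fin n × Bool) × (Fin n × Bool))).filter
          fun p => η * n < hammingDist (g p.1)
            (g (Function.update p.1 a (Function.update (p.1 a) b p.2)))).card : ℝ))
        ≤ (η * n) ^ 2 * (A * (N * (2 * n))) := by
      calc _ ≤ s₂ n * (((m * k : ℕ) : ℝ) * (N * (2 * n))) := hsum.trans hg
        _ = (s₂ n * ((m * k : ℕ) : ℝ)) * (N * (2 * n)) := by ring
        _ ≤ (η * n) ^ 2 * (N * (2 * n)) := mul_le_mul_of_nonneg_right hjumpB (by positivity)
        _ = (η * n) ^ 2 * (1 * (N * (2 * n))) := by ring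
        _ ≤ (η * n) ^ 2 * (A * (N * (2 * n))) := by
            apply mul_le_mul_of_nonneg_left _ hηn.le
            exact mul_le_mul_of_nonneg_right hA1 (by positivity)
    have := le_of_mul_le_mul_left hchain hηn
    simpa only [hN, mul_assoc] using this
  -- the engine and the growing-loss asymptotics
  have hE := Summit.PneNP.PneNP.Cruxes.SolvableImpliesStableSection.Sketch.engine_count k m n hn1 η A
    hη.le hA0 g G hG hjump
  have hasym := sissLip_asy_pointwise (M := m * k) (k := k) (Real.exp_log hxpos) hlog2le ht hMB
  -- assembly (as in `concl_of_smoothSection`)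
  have hpaths : (Fintype.card (Fin (k + 1) → Fin m → Fin k → Fin n × Bool) : ℝ) =
      (2 * n) ^ (m * k * (k + 1)) := by
    rw [Summit.PneNP.PneNP.Cruxes.SolvableImpliesStableSection.Sketch.eng_card_paths]
    push_cast
    ring
  have hmono : ((univ : Finset (Fin (k + 1) → Fin m → Fin k → Fin n × Bool)).filter fun Ψ =>
          (∀ r : Fin k, ∀ q ≤ m * k,
            (fun (a : Fin m) (b : Fin k) =>
              if (a : ℕ) * k + b < q then Ψ r.succ a b else Ψ r.castSucc a b) ∈ G) ∧
          ∀ r : Fin k, ∀ q < m * k,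
            (hammingDist
              (g fun (a : Fin m) (b : Fin k) =>
                if (a : ℕ) * k + b < q then Ψ r.succ a b else Ψ r.castSucc a b)
              (g fun (a : Fin m) (b : Fin k) =>
                if (a : ℕ) * k + b < q + 1 then Ψ r.succ a b else Ψ r.castSucc a b) : ℝ)
              ≤ η * n).card ≤
      ((univ : Finset (Fin (k + 1) → Fin m → Fin k → Fin n × Bool)).filter fun Ψ =>
        let P : Fin k → ℕ → Fin m → Fin k → Fin n × Bool :=
          fun r q a b => if (a : ℕ) * k + b < q then Ψ r.succ a b else Ψ r.castSucc a b
        (∀ r : Fin k, ∀ q ≤ m * k, (((Finset.univ : Finset (Fin m)).filter fun i =>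
          ∀ j, g (P r q) (P r q i j).1 ≠ (P r q i j).2).card : ℝ) ≤ ν * m) ∧
        ∀ r : Fin k, ∀ q < m * k,
          (hammingDist (g (P r q)) (g (P r (q + 1))) : ℝ) ≤ η * n).card := by
    refine Finset.card_le_card fun Ψ hΨ => ?_
    simp only [Finset.mem_filter, Finset.mem_univ, true_and] at hΨ ⊢
    obtain ⟨hin, hjmp⟩ := hΨ
    exact ⟨fun r q hq => hval _ (hin r q hq), fun r q hq => hjmp r q hq⟩
  have hmono' := (Nat.cast_le (α := ℝ)).2 hmono
  rw [hpaths]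
  linarith only [hasym, hE, hmono']


/-- **Stable sections from polynomially small success, crux shape.** For every `k ≥ 1`, `α, η, ν > 0`
and `s₂` with `s₂(n) log³ n = o(n)`: if the decoded section `Φ ↦ (v ↦ (f ⌜Φ⌝).getD v false)` of some
`f : List Bool → List Bool` on `F_k(n, ⌊α n⌋₊)` has, eventually in `n`, mean-square single-literal
sensitivity at most `s₂(n) ≥ 0`, and `f` solves with probability at least
`8k(2 + 9 s₂(n) log² n)/(ν² m)` for infinitely many `n`, then for every `c > 0`, infinitely often, an
`ηn`-stable `νm`-valid section exists on `≥ e^{-cn}·#paths` of the Bresler–Huang path tuples — the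
conclusion of `SolvableImpliesStableSection` at `(k, α, η, ν)`, from a vanishing success probability. -/
theorem sissMSR_stableSection_of_rateSolvable (k : ℕ) (hk : 1 ≤ k) (α η ν : ℝ)
    (hα : 0 < α) (hη : 0 < η) (hν : 0 < ν) (s₂ : ℕ → ℝ)
    (hs : (fun n : ℕ => s₂ n * Real.log n ^ 3) =o[atTop] (fun n : ℕ => (n : ℝ)))
    (f : List Bool → List Bool)
    (hMS : ∀ᶠ n : ℕ in atTop, ∀ m : ℕ, m = ⌊α * n⌋₊ →
        ∃ g : (Fin m → Fin k → Fin n × Bool) → (Fin n → Bool),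
          (∀ (Φ : Fin m → Fin k → Fin n × Bool) (v : Fin n), g Φ v =
            (f (Literature.Computability.Complexity.encodingCNF.encode (List.ofFn fun a =>
              List.ofFn fun b => (((Φ a b).1 : ℕ), (Φ a b).2)))).getD v false) ∧ 0 ≤ s₂ n ∧
          (∑ a : Fin m, ∑ b : Fin k, ∑ p : (Fin m → Fin k → Fin n × Bool) × (Fin n × Bool),
            (hammingDist (g p.1) (g (Function.update p.1 a (Function.update (p.1 a) b p.2))) : ℝ) ^ 2)
            ≤ s₂ n * (((m * k : ℕ) : ℝ) * (Fintype.card (Fin m → Fin k → Fin n × Bool) * (2 * n))))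
    (hfreq : ∃ᶠ n : ℕ in Filter.atTop, ∀ m : ℕ, m = ⌊α * n⌋₊ →
        8 * k * (2 + 9 * Real.log n ^ 2 * s₂ n) / (ν ^ 2 * m) ≤
        ((Finset.univ.filter fun Φ : Fin m → Fin k → Fin n × Bool => ∀ i, ∃ j,
          (f (Literature.Computability.Complexity.encodingCNF.encode (List.ofFn fun a =>
            List.ofFn fun b => (((Φ a b).1 : ℕ), (Φ a b).2)))).getD (Φ i j).1 false =
              (Φ i j).2).card : ℝ) / Fintype.card (Fin m → Fin k → Fin n × Bool))
    (c : ℝ) (hc : 0 < c) :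
    ∃ᶠ n : ℕ in Filter.atTop, ∀ m : ℕ, m = ⌊α * n⌋₊ →
      ∃ g : (Fin m → Fin k → Fin n × Bool) → (Fin n → Bool),
        Real.exp (-(c * n)) * Fintype.card (Fin (k + 1) → Fin m → Fin k → Fin n × Bool) ≤
        ((Finset.univ.filter fun Ψ : Fin (k + 1) → Fin m → Fin k → Fin n × Bool =>
          let P : Fin k → ℕ → Fin m → Fin k → Fin n × Bool :=
            fun r q a b => if (a : ℕ) * k + b < q then Ψ r.succ a b else Ψ r.castSucc a b
          (∀ r : Fin k, ∀ q ≤ m * k, ((Finset.univ.filter fun i : Fin m =>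
            ∀ j, g (P r q) (P r q i j).1 ≠ (P r q i j).2).card : ℝ) ≤ ν * m) ∧
          ∀ r : Fin k, ∀ q < m * k,
            (hammingDist (g (P r q)) (g (P r (q + 1))) : ℝ) ≤ η * n).card : ℝ) := by
  refine sissMSR_concl_of_rateSolver k hk α η ν hα hη hν s₂ hs ?_ c hc
  refine (hfreq.and_eventually (hMS.and (eventually_ge_atTop 1))).mono ?_
  rintro n ⟨hn, hMSn, hn1⟩ m hm
  obtain ⟨g, hgf, hs0, hg⟩ := hMSn m hm
  refine ⟨g, hs0, hg, ?_⟩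
  have h := hn m hm
  haveI : Nonempty (Fin n × Bool) := ⟨(⟨0, hn1⟩, false)⟩
  have hN : (0 : ℝ) < Fintype.card (Fin m → Fin k → Fin n × Bool) := by
    exact_mod_cast Fintype.card_pos
  rw [le_div_iff₀ hN] at h
  have hset : ((Finset.univ.filter fun Φ : Fin m → Fin k → Fin n × Bool => ∀ i, ∃ j,
      (f (Literature.Computability.Complexity.encodingCNF.encode (List.ofFn fun a =>
        List.ofFn fun b => (((Φ a b).1 : ℕ), (Φ a b).2)))).getD (Φ i j).1 false = (Φ i j).2))
      = (Finset.univ.filter fun Φ : Fin m → Fin k → Fin n × Bool =>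
          ∀ i, ∃ j, g Φ (Φ i j).1 = (Φ i j).2) := by
    refine Finset.filter_congr fun Φ _ => ?_
    simp only [hgf]
  rw [hset] at h
  exact h

end Summit.PneNP.PneNP.Theorems
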